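import Summits.ABC.StewartYu.PadicTwistMain
import Summits.ABC.StewartYu.SiegelOnFinset
import Summits.ABC.StewartYu.DescentIntegralityQ
import HarnessLib

/-!
# Cell abc-stewartyu, WP-Y3 (viii): Siegel's lemma ON A CLASS for the twisted descent (level `0`)

`Summits/ABC/StewartYu/PadicTwistSiegel.lean` — cell `abc-stewartyu` (seat p2; crux
`YuNinetyThreeModFour` stmt-ABC-19249, line `twist-w80`), sequel to `PadicTwistMain.lean`.
Theorems only; no named fact.  Yu's Lemma 2.1 [Yu 1990, §2.3, pp. 40–43] in the cell's language:
the unknowns of the box of level `0` are sorted by their class value `cls u ∈ μ_G ⊂ ℚ_p`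
(`#μ_G ≤ G`), a class `U` with `#box₀ ≤ G · #U` exists by pigeonhole (p3's
`SiegelFinset.exists_class_card_ge`), and p3's set-up-free Siegel lemma
(`SiegelFinset.exists_int_vec_of_finset`) on the unknowns of `U` with the sign-free cleared
coefficients (`SetupQ.exists_int_Dclear_mul_qTerm`) produces the CLASSED invariant `TwistSetup.Inv`
at level `0` — provided the count pays the class price: `2 · G · #eqs ≤ #box₀`
(`siegel_class`).  The coefficient bound `Amax` and the count are the parameter system's.

## References
* [Yu1990] K. Yu, *Linear forms in p-adic logarithms II*, Compositio Math. 74 (1990), §2.3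
  Lemma 2.1 and (2.32) (the count with the class price `G₀`).
-/

noncomputable section

open Finset
open Literature.NumberTheory.Transcendental
open Literature.NumberTheory.Transcendental.CW77.Setup (Idx Tau tauNorm tauSet mem_tauSet)

namespace Summit.ABC.StewartYu

namespace TwistSetup

variable {p : ℕ} [Fact p.Prime] (S : TwistSetup p) {h Lb : ℕ}

/-- The finite set `μ_G(ℚ_p)` of `G`-th roots of unity (as a Finset of `ℚ_p`), home of the class
values. [folklore] -/
def rootSet : Finset ℚ_[p] := Polynomial.nthRootsFinset S.G (1 : ℚ_[p])

/-- `cls u ∈ μ_G`. [folklore] -/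
theorem cls_mem_rootSet (u : Idx S.d h Lb) : S.cls u ∈ S.rootSet := by
  unfold rootSet
  rw [Polynomial.mem_nthRootsFinset S.hG]
  exact S.cls_pow_G u

/-- `#μ_G ≤ G`. [folklore] -/
theorem card_rootSet_le : S.rootSet.card ≤ S.G := by
  classical
  unfold rootSet
  rw [Polynomial.nthRootsFinset_def]
  exact (Multiset.toFinset_card_le _).trans (Polynomial.card_nthRoots _ _)

/-- The class value as an element of the finite type `↥μ_G`. [folklore] -/
def clsFin (u : Idx S.d h Lb) : ↥S.rootSet := ⟨S.cls u, S.cls_mem_rootSet u⟩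

/-- **Siegel's lemma on a class** [Yu 1990, Lemma 2.1 with (2.32)]: if the box of level `0` has at
least `2 · G · #eqs` unknowns, where `eqs = {(s, τ) : s < S₀, |τ| < T}` (`S₀, T ≥ 1`), and the cleared
signed coefficients `Dclear(s,τ) · qTerm(u,τ,s)` are bounded by `Amax ≥ 1`, then there are integers
`p(u)`, not all zero, supported in ONE CLASS of the box, bounded by `⌈#box₀ · Amax⌉`, satisfying all
relations of level `0`: the classed invariant `Inv` at `J = 0`. [cite: Yu1990, §2.3 Lemma 2.1] -/
theorem siegel_class (J₀ : ℕ) (L : Fin S.d → ℕ) (Lθ S₀ T : ℕ) (hS₀ : 1 ≤ S₀) (hT : 1 ≤ T)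
    (hcard : 2 * S.G * ((range S₀) ×ˢ tauSet S.d T).card ≤ (S.toQ.flat.box (h := h) (Lb := Lb) L Lθ 0).card)
    {Amax : ℝ} (hAmax : 1 ≤ Amax)
    (hA : ∀ s, s < S₀ → ∀ τ : Tau S.d, tauNorm τ < T → ∀ u ∈ S.toQ.flat.box (h := h) (Lb := Lb) L Lθ 0,
      |((S.toQ.flat.Dclear (h := h) J₀ L Lθ s τ : ℕ) : ℝ) * (S.toQ.qTerm J₀ 0 u τ s : ℝ)| ≤ Amax) :
    ∃ pv : Idx S.d h Lb → ℤ,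
      S.Inv J₀ L Lθ S₀ T ⌈((S.toQ.flat.box (h := h) (Lb := Lb) L Lθ 0).card : ℝ) * Amax⌉ 0 pv := by
  classical
  set boxZ := S.toQ.flat.box (h := h) (Lb := Lb) L Lθ 0 with hboxZ
  set eqs := (range S₀) ×ˢ tauSet S.d T with heqs
  -- the large class
  haveI : Nonempty ↥S.rootSet := ⟨⟨1, by
    unfold rootSet; rw [Polynomial.mem_nthRootsFinset S.hG]; exact one_pow _⟩⟩
  have hγ : Fintype.card ↥S.rootSet ≤ S.G := by
    rw [Fintype.card_coe]; exact S.card_rootSet_le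
  obtain ⟨c, hc⟩ := SiegelFinset.exists_class_card_ge boxZ (S.clsFin (h := h) (Lb := Lb)) hγ
  set U := boxZ.filter (fun u => S.clsFin u = c) with hU
  have hUsub : U ⊆ boxZ := filter_subset _ _
  have hE : eqs.Nonempty := by
    refine ⟨(0, ((0 : ℕ), (0 : Fin S.d → ℕ))), ?_⟩
    rw [heqs, mem_product, mem_range, mem_tauSet]
    unfold tauNorm
    simpa using ⟨hS₀, hT⟩
  have hcount : 2 * eqs.card ≤ U.card :=
    SiegelFinset.two_mul_card_le_of_class S.hG hc (by rw [mul_comm 2 S.G] at hcard; linarith)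
  -- Siegel's lemma on `U`
  obtain ⟨pv, hsupp, hne, hbd, hrel⟩ := SiegelFinset.exists_int_vec_of_finset U eqs hE hcount
    (fun e u => S.toQ.qTerm J₀ 0 u e.2 e.1)
    (fun e => S.toQ.flat.Dclear (h := h) J₀ L Lθ e.1 e.2)
    (fun e _ => S.toQ.flat.Dclear_pos J₀ L Lθ e.1 e.2)
    (fun e _ u hu => S.toQ.exists_int_Dclear_mul_qTerm J₀ (hUsub hu) e.2 e.1)
    hAmax
    (fun e he u hu => by
      rw [heqs, mem_product, mem_range, mem_tauSet] at he
      have := hA e.1 he.1 e.2 he.2 u (hUsub hu)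
      push_cast at this ⊢
      exact this)
  refine ⟨pv, ⟨⟨?_, hne, ?_, ?_⟩, ⟨(c : ℚ_[p]), ?_, ?_⟩⟩⟩
  · -- support
    exact fun u hu => hUsub (hsupp u hu)
  · -- bound
    intro u
    refine (hbd u).trans (Int.ceil_le_ceil ?_)
    exact mul_le_mul_of_nonneg_right (by exact_mod_cast card_le_card hUsub) (by linarith)
  · -- relations at level `0`
    intro s hs _hodd τ hτ
    rw [pow_zero, one_mul] at hs
    rw [pow_zero, Nat.div_one] at hτ
    have hmem : (s, τ) ∈ eqs := by
      rw [heqs, mem_product, mem_range, mem_tauSet]; exact ⟨hs, hτ⟩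
    have h0 := hrel (s, τ) hmem
    -- `coreSum` over the box = the sum over `U` (the support is in `U`)
    unfold SetupQ.coreSum
    rw [← Finset.sum_subset hUsub (fun u _ hu => by
      have : pv u = 0 := by by_contra hne'; exact hu (hsupp u hne')
      rw [this]; simp)]
    exact h0
  · -- the class value is a root of unity
    have := c.2
    unfold rootSet at this
    exact (Polynomial.mem_nthRootsFinset S.hG (1 : ℚ_[p])).mp this
  · -- all non-zero coefficients sit in the class `c`
    intro u hu
    have hUu : u ∈ U := hsupp u hu
    rw [hU, mem_filter] at hUu
    have := congrArg Subtype.val hUu.2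
    exact this

end TwistSetup

end Summit.ABC.StewartYu

end
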